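import Mathlib.Analysis.Normed.Field.Basic
import Mathlib.GroupTheory.OrderOfElement
import Literature.IUT.LogThetaLattice.MultiradialityRemarks
import Literature.IUT.LogThetaLattice.PilotWeights
import HarnessLib

/-!
# [IUTchIII] Rmk 2.3.3 (iii), (iv) and Rmk 2.4.2 (vi): the small printed clauses with a finite kernel — PROVED

Mochizuki, *Inter-universal Teichmüller Theory III*, kurims manuscript (May 2020), §2, Rmk 2.3.3 (iii) p.77 l.23 –
p.78 l.26, (iv) p.78 l.27–47, Rmk 2.4.2 (vi) p.91 l.9–37 [claim: Mochizuki2012, status: disputed] (D-0012 claim key;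
nothing here asserts a disputed claim or takes a side on [IUTchIII] Cor 3.12). PROOF-ONLY companion (theorems, no
definitions) by the zone holder abc-iut-L6-t3 (gen 7; row «IUTchIII-§2-REMARKS-REST») to abc-iut-L6-t4's
`MultiradialityRemarks.lean` (p404443/p404906: the REMARK rows of this seat's [IUTchIII] §1–§2 slice) and to this
seat's `PilotWeights.lean` (p403774); nothing of theirs is restated. The three sub-items are expository; each contains
ONE checkable sentence, proved here at the level print states it.

* **Rmk 2.3.3 (iii)** «the output data in the theta case — i.e., the theta values "`q^{j²}_v`" — depends, in an essential
  way, on the labels `j ∈ 𝔽_l^⋇`» (whereas the copies of `F_mod` do not): `gaussianExponents_injective` — abc-iut-L6-t4's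
  exponent vector `j ↦ j²` ([IUTchII] Rmk 4.11.1) is injective; `thetaValues_injective` — for a `q`-parameter of
  infinite order (any non-torsion element of a commutative group) the values `q^{j²}` are PAIRWISE DISTINCT in `j`;
  `norm_thetaValues_injective` — in a normed field with `0 < ‖q‖ < 1` even their valuations `‖q^{j²}‖ = ‖q‖^{j²}` are
  pairwise distinct («points that have distinct valuations at distinct points», (iv)).
* **Rmk 2.3.3 (iv)** «the existence of a rational function … invariant [up to, say, multiples by roots of unity] with
  respect to the `𝔽_l^{⋊±}`-symmetries that appear, but nevertheless attains values on some `𝔽_l^{⋊±}`-orbit of points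
  that have distinct valuations at distinct points — a situation that is clearly self-contradictory!»:
  `norm_eq_of_invariant_upToUnits` — a function on a `Γ`-set with values in a normed division ring that is invariant
  up to norm-one factors has CONSTANT norm along every orbit; `not_invariant_upToUnits_of_norm_ne` — the printed
  contradiction; `not_invariant_upToUnits_thetaValues` — in particular NO function invariant up to norm-one factors
  under a transitive action on the labels takes the theta values `q^{j²}` (`0 < ‖q‖ < 1`, at least two labels).
* **Rmk 2.4.2 (vi)** «`M = Pic(*𝒞^⊩)` … yields a common container … in which distinct choices of the [negative!]
  pilot element … — hence also the data … reconstructed from such distinct choices … — may be compared with one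
  another. By contrast, … positive and negative "`η_M ∈ M`" … may only be compared … in some … larger ambient
  category»: over this seat's `PlaceWeights.MTri η v ⊆ M_v = M` (Rmk 2.4.2 (iv)): `MTri_arc_eq` — at `v ∈ V̲^arc` the
  datum does not depend on the pilot; `MTri_le_nonposReal` — for EVERY negative pilot the data lie in the one
  sub-container `M_{≤0}` (comparable); `MTri_non_eq_iff` — at `v ∈ V̲^non` two negative pilots give the SAME datum iff
  they are equal (distinct choices are distinguished inside the common container); `MTri_non_inf_eq_bot_of_pos_of_neg`
  — a positive and a negative pilot give data meeting only in `0` (no comparison inside `M▶`).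
HONEST FRAMING: elementary algebra over the cell's own typed vocabulary; nothing here bears on [IUTchIII] Cor 3.12;
typed ≠ proved for the series' claims; covered ≠ endorsed; no side taken.
-/

namespace Literature.IUT.LogThetaLattice

universe u

/-! ### Rmk 2.3.3 (iii): the theta values depend essentially on the labels -/

namespace MultiradialityRemarks

/-- **IUTchIII:Rmk2.3.3(iii)** (kurims p.77 l.33–43) the exponent vector `j ↦ j²` (`j = 1, …, l^⋇`) of the
`Θ^{×μ}_{gau}`-link (abc-iut-L6-t4's `gaussianExponents`, Rmk 2.2.2 (i)) is INJECTIVE: distinct labels, distinct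
exponents. [claim: Mochizuki2012, status: disputed] -/
theorem gaussianExponents_injective (lstar : ℕ) : Function.Injective (gaussianExponents lstar) := by
  intro j k h
  simp only [gaussianExponents] at h
  have := Nat.pow_left_injective (n := 2) two_ne_zero h
  exact Fin.ext (by omega)

/-- **IUTchIII:Rmk2.3.3(iii)** (kurims p.77 l.33–43) «the output data in the theta case — i.e., the theta values
"`q^{j²}_v`" — depends, in an essential way, on the labels `j ∈ 𝔽_l^⋇`»: for a `q`-parameter of infinite order (a
non-torsion element of any commutative group — the `q`-parameter of a Tate curve is not a root of unity) the theta
values `q^{j²}`, `j = 1, …, l^⋇`, are PAIRWISE DISTINCT. (The copies of `F_mod` of the number-field case form the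
constant family — «independent of these labels».) [claim: Mochizuki2012, status: disputed] -/
theorem thetaValues_injective {A : Type u} [CommGroup A] {q : A} (hq : ¬ IsOfFinOrder q) (lstar : ℕ) :
    Function.Injective (fun j : Fin lstar => q ^ gaussianExponents lstar j) :=
  (injective_pow_iff_not_isOfFinOrder.mpr hq).comp (gaussianExponents_injective lstar)

/-- **IUTchIII:Rmk2.3.3(iii)** (kurims p.77 l.33–43; (iv) p.78 l.44–46 «distinct valuations at distinct points») in a
normed field with `0 < ‖q‖ < 1` (the `q`-parameter at `v ∈ V̲^bad`) the VALUATIONS of the theta values,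
`‖q^{j²}‖ = ‖q‖^{j²}`, are already pairwise distinct in the label `j`. [claim: Mochizuki2012, status: disputed] -/
theorem norm_thetaValues_injective {K : Type u} [NormedField K] {q : K} (hq0 : 0 < ‖q‖) (hq1 : ‖q‖ < 1)
    (lstar : ℕ) : Function.Injective (fun j : Fin lstar => ‖q ^ gaussianExponents lstar j‖) := by
  intro j k h
  simp only [norm_pow] at h
  exact gaussianExponents_injective lstar ((pow_right_strictAnti₀ hq0 hq1).injective h)

/-! ### Rmk 2.3.3 (iv): a function invariant up to roots of unity has constant valuation on orbits -/

/-- **IUTchIII:Rmk2.3.3(iv)** (kurims p.78 l.38–47) KERNEL of the printed «self-contradiction»: let a group `Γ` act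
on a set of points `X` and let `f : X → L` (values in a normed division ring) be «invariant [up to, say, multiples
by roots of unity] with respect to the symmetries» — here: `f (γ • x) = ζ · f x` with `‖ζ‖ = 1`. Then `f` has the
SAME valuation at all points of one orbit: `‖f (γ • x)‖ = ‖f x‖`. [claim: Mochizuki2012, status: disputed] -/
theorem norm_eq_of_invariant_upToUnits {Γ : Type*} [Group Γ] {X : Type*} [MulAction Γ X] {L : Type*}
    [NormedDivisionRing L] (f : X → L) (hf : ∀ (γ : Γ) (x : X), ∃ ζ : L, ‖ζ‖ = 1 ∧ f (γ • x) = ζ * f x)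
    (γ : Γ) (x : X) : ‖f (γ • x)‖ = ‖f x‖ := by
  obtain ⟨ζ, hζ, h⟩ := hf γ x
  rw [h, norm_mul, hζ, one_mul]

/-- **IUTchIII:Rmk2.3.3(iv)** (kurims p.78 l.38–47) «the existence of a rational function … that is invariant [up to,
say, multiples by roots of unity] with respect to the `𝔽_l^{⋊±}`-symmetries that appear, but nevertheless attains values
on some `𝔽_l^{⋊±}`-orbit of points that have distinct valuations at distinct points — a situation that is clearly
self-contradictory!»: two points of one orbit with distinct valuations of `f` REFUTE invariance up to norm-one
factors. [claim: Mochizuki2012, status: disputed] -/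
theorem not_invariant_upToUnits_of_norm_ne {Γ : Type*} [Group Γ] {X : Type*} [MulAction Γ X] {L : Type*}
    [NormedDivisionRing L] (f : X → L) {γ : Γ} {x : X} (hne : ‖f (γ • x)‖ ≠ ‖f x‖) :
    ¬ ∀ (γ : Γ) (x : X), ∃ ζ : L, ‖ζ‖ = 1 ∧ f (γ • x) = ζ * f x :=
  fun hf => hne (norm_eq_of_invariant_upToUnits f hf γ x)

/-- **IUTchIII:Rmk2.3.3(iv)** (kurims p.78 l.27–47) … in particular, for ANY transitive action of a group on the
labels `j = 1, …, l^⋇` (`l^⋇ ≥ 2`) — such as the symmetries permuting the evaluation points — NO function invariant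
up to norm-one factors takes the theta values `j ↦ q^{j²}` (`0 < ‖q‖ < 1`): their valuations are pairwise distinct
(`norm_thetaValues_injective`). This is the naive-Kummer-approach reading that print calls self-contradictory; the
theta case escapes it through mono-theta-theoretic cyclotomic rigidity, not through naive invariance (expository
remainder of (iv)). [claim: Mochizuki2012, status: disputed] -/
theorem not_invariant_upToUnits_thetaValues {Γ : Type*} [Group Γ] {lstar : ℕ} [MulAction Γ (Fin lstar)]
    [MulAction.IsPretransitive Γ (Fin lstar)] (hl : 2 ≤ lstar) {K : Type u} [NormedField K] {q : K}
    (hq0 : 0 < ‖q‖) (hq1 : ‖q‖ < 1) :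
    ¬ ∀ (γ : Γ) (j : Fin lstar), ∃ ζ : K, ‖ζ‖ = 1 ∧
        q ^ gaussianExponents lstar (γ • j) = ζ * q ^ gaussianExponents lstar j := by
  intro hf
  obtain ⟨γ, hγ⟩ := MulAction.exists_smul_eq Γ (⟨0, by omega⟩ : Fin lstar) ⟨1, by omega⟩
  have h := norm_eq_of_invariant_upToUnits (fun j : Fin lstar => q ^ gaussianExponents lstar j) hf γ
    ⟨0, by omega⟩
  simp only [hγ] at h
  have := norm_thetaValues_injective hq0 hq1 lstar h
  exact absurd (congrArg Fin.val this) (by norm_num)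

end MultiradialityRemarks

/-! ### Rmk 2.4.2 (vi): the common container and the comparison of pilot elements -/

namespace PlaceWeights

variable {V : Type*} [Fintype V] (W : PlaceWeights V)

/-- **IUTchIII:Rmk2.4.2(vi)** (kurims p.91 l.9–24) at `v ∈ V̲^arc` the datum `M▶_v = M_{≤ 0}` does not depend on the
pilot element at all (Rmk 2.4.2 (iv)). [claim: Mochizuki2012, status: disputed] -/
theorem MTri_arc_eq {v : V} (hv : W.isArc v) (η η' : ℝ) : W.MTri η v = W.MTri η' v := by
  ext x
  rw [W.mem_MTri_arc_iff hv, W.mem_MTri_arc_iff hv]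

/-- **IUTchIII:Rmk2.4.2(vi)** (kurims p.91 l.9–24) «a common container … in which distinct choices of the [negative!]
pilot element … may be compared with one another»: for EVERY negative pilot `η` and every `v`, the datum `M▶_v` lies in
the one sub-container `M_{≤0} ⊆ M` (this seat's `nonpos_of_mem_MTri`), so the data attached to two negative pilots
are sub-objects of the same ordered monoid. [claim: Mochizuki2012, status: disputed] -/
theorem MTri_le_nonposReal {η : ℝ} (hη : η < 0) (v : V) : W.MTri η v ≤ nonposReal :=
  fun _ hx => (mem_nonposReal _).mpr (W.nonpos_of_mem_MTri hη hx)

/-- **IUTchIII:Rmk2.4.2(vi)** (kurims p.91 l.15–24) … and inside that common container DISTINCT choices are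
distinguished: at `v ∈ V̲^non` two negative pilot elements give the same datum `M▶_v = ℕ·η` iff they are EQUAL
(«distinct choices of the [negative!] pilot element — hence also the data … reconstructed from such distinct
choices»). [claim: Mochizuki2012, status: disputed] -/
theorem MTri_non_eq_iff {v : V} (hv : ¬ W.isArc v) {η η' : ℝ} (hη : η < 0) (hη' : η' < 0) :
    W.MTri η v = W.MTri η' v ↔ η = η' := by
  refine ⟨fun h => ?_, fun h => by rw [h]⟩
  have h1 : η ∈ W.MTri η' v := h ▸ W.eta_mem_MTri hη v
  have h2 : η' ∈ W.MTri η v := h.symm ▸ W.eta_mem_MTri hη' v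
  obtain ⟨n, hn⟩ := (W.mem_MTri_non_iff hv η).mp h1
  obtain ⟨m, hm⟩ := (W.mem_MTri_non_iff hv η').mp h2
  rw [nsmul_eq_mul] at hn hm
  -- `η = n η'`, `η' = m η` with `η, η' < 0` force `n = m = 1`
  have hn0 : n ≠ 0 := by
    rintro rfl
    rw [Nat.cast_zero, zero_mul] at hn
    exact hη.ne hn.symm
  have hm0 : m ≠ 0 := by
    rintro rfl
    rw [Nat.cast_zero, zero_mul] at hm
    exact hη'.ne hm.symm
  have hn1 : (1 : ℝ) ≤ n := by exact_mod_cast Nat.one_le_iff_ne_zero.mpr hn0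
  have hm1 : (1 : ℝ) ≤ m := by exact_mod_cast Nat.one_le_iff_ne_zero.mpr hm0
  have hprod : (n : ℝ) * m * η = η := by
    calc (n : ℝ) * m * η = n * (m * η) := by ring
      _ = n * η' := by rw [hm]
      _ = η := hn
  have hnm : (n : ℝ) * m = 1 := by
    have := mul_right_cancel₀ hη.ne (hprod.trans (one_mul η).symm)
    exact this
  have hn' : (n : ℝ) = 1 := le_antisymm (by nlinarith) hn1
  rw [hn', one_mul] at hn
  exact hn.symm

/-- **IUTchIII:Rmk2.4.2(vi)** (kurims p.91 l.25–37) «By contrast, if one attempts to compare the constructions of (v)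
applied to positive and negative "`η_M ∈ M`" [i.e., which amounts to reversing the order structure on `M`!] … such
Frobenioids may only be compared … in some sort of larger ambient category»: at `v ∈ V̲^non` the datum of a NEGATIVE
pilot and that of a POSITIVE pilot meet only in `0` — neither contains the other's pilot, no comparison takes place
inside `M▶`. [claim: Mochizuki2012, status: disputed] -/
theorem MTri_non_inf_eq_bot_of_pos_of_neg {v : V} (hv : ¬ W.isArc v) {η η' : ℝ} (hη : η < 0) (hη' : 0 < η') :
    W.MTri η v ⊓ W.MTri η' v = ⊥ := by
  rw [eq_bot_iff]
  intro x hx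
  rw [AddSubmonoid.mem_inf] at hx
  have h1 : x ≤ 0 := W.nonpos_of_mem_MTri hη hx.1
  obtain ⟨m, rfl⟩ := (W.mem_MTri_non_iff hv x).mp hx.2
  have h2 : 0 ≤ m • η' := by rw [nsmul_eq_mul]; exact mul_nonneg m.cast_nonneg hη'.le
  rw [AddSubmonoid.mem_bot]
  exact le_antisymm h1 h2

end PlaceWeights

end Literature.IUT.LogThetaLattice
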